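import Literature.Probability.LatticeModels.CriticalUrsellFourSign
import Literature.Probability.LatticeModels.AizenmanWickBoundProofs
import Literature.Probability.LatticeModels.TreeGraphWickPairInteraction
import HarnessLib

/-!
# Gaussian dichotomy for pointwise scaling limits of the critical Ising correlators

Topic `Probability/LatticeModels`; family `crit-ising`. THEOREM-ONLY leaf file (no definitions, no
named facts). For the nearest-neighbour Ising model on `ℤ^d`, `d ≥ 3`, critical state
`criticalCorr d` (`⟨∏ᵢ σ_{yᵢ}⟩_{β_c}`):

* `abs_criticalCorr_sub_pairingSum_le` — **Aizenman's Proposition 12.1 for the critical state in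
  infinite volume**: for `n ≥ 2` and every `y : Fin (2n) → ℤ^d` (coincidences allowed),
  `|⟨∏σ_{yᵢ}⟩_{β_c} - 𝒢_n[⟨σσ⟩_{β_c}](y)| ≤ (3/2) R_{2n}(y)`, `R_{2n} = ∑_{4-subsets} |U₄| · 𝒢_{n-2}`
  (`wickRemainder`); box limit (free boundary condition, `criticalCorr_wellDefined_holds`) of the tree
  THEOREM `aizenman_wickDeviation_le_finite_holds` through `wickDeviation_le_box`.
* `HasPointwiseScalingLimit.eq_pairingSum_of_limitConnectedFour_eq_zero` — **the dichotomy**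
  (Aizenman, CDM 2020, remark after Prop. 7.2, p. 23: "(7.1) is homogeneous of degree 1 in each of
  the spin variables, and hence the relation passes onto the scaling limit. It follows that the limit
  is Gaussian if and only if … the Wick law holds at the level of the 4-point function"): if `S` is a
  pointwise scaling limit of `criticalCorr d` (`HasPointwiseScalingLimit`, ANY renormalisation `ρ`, no
  non-degeneracy assumed) whose connected four-point function `U₄^S = limitConnectedFour S` vanishes
  on non-coincident configurations, then `S` obeys Wick's rule at every even order `2n ≥ 4` on
  non-coincident configurations, `S_{2n}(x) = 𝒢_n[S₂](x)` with `S₂(p,q) = S 2 ![p,q]`; odd orders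
  vanish for every limit (`HasPointwiseScalingLimit.eq_zero_of_odd`, from `m*(β_c) = 0`).
* `HasPointwiseScalingLimit.hasNontrivialU4_of_ne_pairingSum`, `hasNontrivialU4_or_wick` — the
  prover's reading of clause (iii) of the conformal-limit problem on `ℤ³` (`HasNontrivialU4`): a
  pointwise limit of the critical correlators is EITHER the Wick (Gaussian) family of its own
  two-point function at all orders, OR has `U₄ ≠ 0` (indeed `U₄ < 0`,
  `hasNontrivialU4_iff_exists_neg_of_hasPointwiseScalingLimit`) at some non-coincident quadruple;
  any deviation from Wick's rule at ANY even order at ONE non-coincident configuration already gives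
  `HasNontrivialU4 S`. There is no intermediate ("non-Gaussian but `U₄ ≡ 0` off the diagonals")
  scenario to build a counterexample from, and no weaker target than full Gaussianity for a
  refutation.

Technique: the lattice inequality is rescaled by `ρ(δ)^{2n} = (ρ²)ⁿ ≥ 0` at the points `[xᵢ/δ]`
and rewritten at the level of INDICES (`PairIsing.pairingSum_eq_pow_mul`, `wickRemainder_eq_pow_mul_of_ne`:
pairings and `4`-subsets only read distinct indices, so diagonal / non-injective entries may be set
to `0`), after which `tendsto_pairingSum` / `tendsto_wickRemainder` pass to the limit `δ → 0⁺` using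
the convergence of the rescaled two- and four-point data at non-coincident configurations only.

## References

* M. Aizenman, Comm. Math. Phys. 86 (1982) 1–48, Prop. 12.1, eq. (12.3) [AizenmanCMP1982].
* M. Aizenman, *A geometric perspective on the scaling limits of critical Ising and `φ⁴_d` models*,
  CDM 2020 (arXiv:2112.04248), Prop. 7.1 (Newman), Prop. 7.2, remark p. 23 [AizenmanCDM2020].
* C. M. Newman, Comm. Math. Phys. 41 (1975) 1–9 (Gaussianity from `U₄ ≡ 0`) [Newman1975].
-/

noncomputable section

namespace Literature.Probability.LatticeModels

open _root_.MeasureTheory Filter Finset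
open scoped _root_.Topology

variable {d : ℕ}

/-! ### Rescaling `R_{2n}` along injective relabellings (`𝒢_n`: `PairIsing.pairingSum_eq_pow_mul`) -/

/-- Rescaling of Aizenman's remainder along an injective relabelling: if `S'(yᵢ,yⱼ) = s·S(zᵢ,zⱼ)`
for distinct indices and `U'(y∘e) = s²·U(z∘e)` for injective `e : Fin 4 → Fin (2n)`, then
`R_{2n}[S',U'](y) = sⁿ R_{2n}[S,U](z)` (`n ≥ 2`; the selected quadruple and the remaining `2n-4`
indices are injective enumerations). [folklore] -/
theorem wickRemainder_eq_pow_mul_of_ne {α α' : Type*} (S : α → α → ℝ) (S' : α' → α' → ℝ)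
    (U : (Fin 4 → α) → ℝ) (U' : (Fin 4 → α') → ℝ) (s : ℝ) {n : ℕ} (hn : 2 ≤ n)
    (z : Fin (2 * n) → α) (y : Fin (2 * n) → α')
    (hS : ∀ i j, i ≠ j → S' (y i) (y j) = s * S (z i) (z j))
    (hU : ∀ e : Fin 4 → Fin (2 * n), Function.Injective e → U' (y ∘ e) = s ^ 2 * U (z ∘ e)) :
    wickRemainder S' U' n y = s ^ n * wickRemainder S U n z := by
  unfold wickRemainder
  rw [Finset.mul_sum]
  refine Finset.sum_congr rfl fun t _ => ?_
  have h4 : U' (restrictFour y t) = s ^ 2 * U (restrictFour z t) :=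
    hU _ (t.1.orderEmbOfFin t.2).injective
  have hginj : Function.Injective
      (removeFour₂ (id : Fin (2 * n) → Fin (2 * n)) t) := by
    unfold removeFour₂ removeFour
    exact (Function.injective_id.comp
      (t.1ᶜ.orderEmbOfFin (card_compl_of_card_eq_four t)).injective).comp (Fin.cast_injective _)
  have hrem : pairingSum S' (n - 2) (removeFour₂ y t) =
      s ^ (n - 2) * pairingSum S (n - 2) (removeFour₂ z t) := by
    rw [show removeFour₂ y t = y ∘ removeFour₂ id t from rfl,
      show removeFour₂ z t = z ∘ removeFour₂ id t from rfl]
    exact PairIsing.pairingSum_eq_pow_mul S S' s (n - 2) _ _ fun i j hij => hS _ _ (hginj.ne hij)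
  have hpow : s ^ 2 * s ^ (n - 2) = s ^ n := by rw [← pow_add, Nat.add_sub_cancel' hn]
  rw [h4, hrem, abs_mul, abs_pow, sq_abs, ← hpow]
  ring

/-! ### Aizenman's Proposition 12.1 for the critical state on `ℤ^d` -/

/-- **Deviation from Wick's law for the critical state, `d ≥ 3`** (Aizenman 1982, Prop. 12.1 in
infinite volume): for `n ≥ 2` and `y : Fin (2n) → ℤ^d`,
`|⟨∏σ_{yᵢ}⟩_{β_c} - 𝒢_n[⟨σσ⟩_{β_c}](y)| ≤ (3/2) ∑_{4-subsets t} |U₄(y_t)| 𝒢_{n-2}[⟨σσ⟩_{β_c}](y_{tᶜ})`.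
Box limit of `wickDeviation_le_box aizenman_wickDeviation_le_finite_holds` along the free-boundary
boxes `Λ_L ↑ ℤ^d`, every correlator converging to the critical one (`criticalCorr_wellDefined_holds`).
[cite: AizenmanCMP1982, Prop. 12.1, eq. (12.3)] [cite: AizenmanCDM2020, Prop. 7.2, eq. (7.1)] -/
theorem abs_criticalCorr_sub_pairingSum_le (hd : 3 ≤ d) {n : ℕ} (hn : 2 ≤ n)
    (y : Fin (2 * n) → Site d) :
    |criticalCorr d (2 * n) y - pairingSum (fun a b => criticalCorr d 2 ![a, b]) n y| ≤
      3 / 2 * wickRemainder (fun a b => criticalCorr d 2 ![a, b])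
        (fun u => criticalCorr d 4 u - (criticalCorr d 2 ![u 0, u 1] * criticalCorr d 2 ![u 2, u 3]
          + criticalCorr d 2 ![u 0, u 2] * criticalCorr d 2 ![u 1, u 3]
          + criticalCorr d 2 ![u 0, u 3] * criticalCorr d 2 ![u 1, u 2])) n y := by
  classical
  have hmem : (BoundaryCondition.free : BoundaryCondition (Site d)) ∈
      ({.free, .plus, .minus} : Set (BoundaryCondition (Site d))) := by simp
  have hN : Tendsto (fun L : ℕ => nPoint (isingMeasure (zdGraph d) (box d L) (criticalBeta d) 0 .free)
      spinAt y) atTop (𝓝 (criticalCorr d (2 * n) y)) :=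
    criticalCorr_wellDefined_holds (d := d) hd (2 * n) y .free hmem
  have hT : ∀ a b : Site d, Tendsto (fun L : ℕ => twoPoint (isingMeasure (zdGraph d) (box d L)
      (criticalBeta d) 0 .free) spinAt a b) atTop (𝓝 (criticalCorr d 2 ![a, b])) := by
    intro a b
    refine Tendsto.congr (fun L => ?_) (criticalCorr_wellDefined_holds (d := d) hd 2 ![a, b] .free hmem)
    simp only [twoPoint, isingExpect, spinMonomial, Fin.prod_univ_two, Matrix.cons_val_zero,
      Matrix.cons_val_one]
  have hC := fun u : Fin 4 → Site d => tendsto_connectedFour_box_criticalBeta hd u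
  refine le_of_tendsto_of_tendsto ((hN.sub (tendsto_pairingSum hT n y)).abs)
    (Tendsto.const_mul _ (tendsto_wickRemainder hT hC n y)) ?_
  filter_upwards [eventually_forall_mem_box y] with L hL
  exact wickDeviation_le_box aizenman_wickDeviation_le_finite_holds (box d L) (criticalBeta_nonneg d)
    hn y hL

/-! ### The dichotomy for pointwise scaling limits -/

/-- **Odd orders of every pointwise limit vanish** (`d ≥ 3`, any `ρ`): the odd critical correlators
are identically `0` (`criticalCorr_eq_zero_of_odd`, i.e. `m*(β_c) = 0`). [cite: AizenmanDuminilCopinSidoraviciusCMP2015, Thm. 1.2] -/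
theorem HasPointwiseScalingLimit.eq_zero_of_odd (hd : 3 ≤ d) {ρ : ℝ → ℝ} {S : CorrFamily d}
    (hlim : HasPointwiseScalingLimit (criticalCorr d) ρ S) {n : ℕ} (hn : Odd n)
    {x : Fin n → EuclideanSpace ℝ (Fin d)} (hx : x ∈ NonCoincident d n) : S n x = 0 := by
  have h := (hlim n).tendsto_at hx
  have h0 : Tendsto (fun δ => rescaledCorrelator (criticalCorr d) ρ n δ x) (𝓝[>] 0) (𝓝 0) := by
    refine tendsto_const_nhds.congr fun δ => ?_
    rw [rescaledCorrelator_apply, criticalCorr_eq_zero_of_odd hd hn, mul_zero]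
  exact tendsto_nhds_unique h h0

/-- **Gaussian dichotomy, Wick side** (Aizenman CDM 2020, p. 23, pointwise form): a pointwise scaling
limit `S` of the critical correlators on `ℤ^d`, `d ≥ 3` (any renormalisation `ρ`), whose connected
four-point function vanishes at all non-coincident quadruples obeys Wick's rule at every even order
`2n ≥ 4` on non-coincident configurations: `S_{2n}(x) = 𝒢_n[S₂](x)`. [cite: AizenmanCDM2020, §7, Prop. 7.2 and the remark following it (p. 23)] [cite: AizenmanCMP1982, Prop. 12.1] -/
theorem HasPointwiseScalingLimit.eq_pairingSum_of_limitConnectedFour_eq_zero (hd : 3 ≤ d)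
    {ρ : ℝ → ℝ} {S : CorrFamily d} (hlim : HasPointwiseScalingLimit (criticalCorr d) ρ S)
    (hU : ∀ z ∈ NonCoincident d 4, limitConnectedFour S z = 0) {n : ℕ} (hn : 2 ≤ n)
    {x : Fin (2 * n) → EuclideanSpace ℝ (Fin d)} (hx : x ∈ NonCoincident d (2 * n)) :
    S (2 * n) x = pairingSum (fun p q => S 2 ![p, q]) n x := by
  classical
  have hinj : Function.Injective x := hx
  -- lattice data at mesh `δ`, read at the level of INDICES (diagonal / non-injective entries zeroed)
  set C2 : Site d → Site d → ℝ := fun a b => criticalCorr d 2 ![a, b] with hC2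
  set U4c : (Fin 4 → Site d) → ℝ := fun u => criticalCorr d 4 u - (C2 (u 0) (u 1) * C2 (u 2) (u 3)
      + C2 (u 0) (u 2) * C2 (u 1) (u 3) + C2 (u 0) (u 3) * C2 (u 1) (u 2)) with hU4c
  set z : ℝ → Fin (2 * n) → Site d := fun δ i => latticeApprox δ (x i) with hz
  set T : ℝ → Fin (2 * n) → Fin (2 * n) → ℝ := fun δ i j =>
      if i = j then 0 else ρ δ ^ 2 * C2 (z δ i) (z δ j) with hT
  set T₀ : Fin (2 * n) → Fin (2 * n) → ℝ := fun i j => if i = j then 0 else S 2 ![x i, x j] with hT₀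
  set V : ℝ → (Fin 4 → Fin (2 * n)) → ℝ := fun δ e =>
      if Function.Injective e then ρ δ ^ 4 * U4c (z δ ∘ e) else 0 with hV
  -- (1) index-level rescaling identities
  have hP : ∀ δ, pairingSum (T δ) n id = (ρ δ ^ 2) ^ n * pairingSum C2 n (z δ) := fun δ =>
    PairIsing.pairingSum_eq_pow_mul C2 (T δ) (ρ δ ^ 2) n (z δ) id fun i j hij => by
      simp only [hT, id, if_neg hij]
  have hR : ∀ δ, wickRemainder (T δ) (V δ) n id = (ρ δ ^ 2) ^ n * wickRemainder C2 U4c n (z δ) :=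
    fun δ => wickRemainder_eq_pow_mul_of_ne C2 (T δ) U4c (V δ) (ρ δ ^ 2) hn (z δ) id
      (fun i j hij => by simp only [hT, id, if_neg hij])
      (fun e he => by
        simp only [hV, Function.id_comp, if_pos he]
        ring)
  -- (2) the rescaled lattice inequality at mesh `δ`
  have hineq : ∀ δ, |ρ δ ^ (2 * n) * criticalCorr d (2 * n) (z δ) - pairingSum (T δ) n id| ≤
      3 / 2 * wickRemainder (T δ) (V δ) n id := by
    intro δ
    have h : |criticalCorr d (2 * n) (z δ) - pairingSum C2 n (z δ)| ≤
        3 / 2 * wickRemainder C2 U4c n (z δ) := abs_criticalCorr_sub_pairingSum_le hd hn (z δ)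
    have hc : 0 ≤ (ρ δ ^ 2) ^ n := by positivity
    rw [hP, hR, pow_mul, ← mul_sub, abs_mul, abs_of_nonneg hc]
    calc (ρ δ ^ 2) ^ n * |criticalCorr d (2 * n) (z δ) - pairingSum C2 n (z δ)|
        ≤ (ρ δ ^ 2) ^ n * (3 / 2 * wickRemainder C2 U4c n (z δ)) := mul_le_mul_of_nonneg_left h hc
      _ = 3 / 2 * ((ρ δ ^ 2) ^ n * wickRemainder C2 U4c n (z δ)) := by ring
  -- (3) limits along `δ → 0⁺`
  have hpair : ∀ i j, i ≠ j → Tendsto (fun δ => ρ δ ^ 2 * C2 (z δ i) (z δ j)) (𝓝[>] 0)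
      (𝓝 (S 2 ![x i, x j])) := by
    intro i j hij
    have hmem : (![x i, x j] : Fin 2 → EuclideanSpace ℝ (Fin d)) ∈ NonCoincident d 2 :=
      pair_mem_nonCoincident fun h => hij (hinj h)
    refine Tendsto.congr (fun δ => ?_) ((hlim 2).tendsto_at hmem)
    rw [rescaledCorrelator_apply, latticeApprox_comp_two]
    rfl
  have hTlim : ∀ i j, Tendsto (fun δ => T δ i j) (𝓝[>] 0) (𝓝 (T₀ i j)) := by
    intro i j
    by_cases hij : i = j
    · simp only [hT, hT₀, if_pos hij]
      exact tendsto_const_nhds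
    · simp only [hT, hT₀, if_neg hij]
      exact hpair i j hij
  have hVlim : ∀ e : Fin 4 → Fin (2 * n), Tendsto (fun δ => V δ e) (𝓝[>] 0)
      (𝓝 ((fun _ : Fin 4 → Fin (2 * n) => (0 : ℝ)) e)) := by
    intro e
    by_cases he : Function.Injective e
    · simp only [hV, if_pos he]
      have hxe : (x ∘ e) ∈ NonCoincident d 4 := hinj.comp he
      have h1 : Tendsto (fun δ => ρ δ ^ 4 * U4c (z δ ∘ e)) (𝓝[>] 0)
          (𝓝 (limitConnectedFour S (x ∘ e))) := tendsto_rescaled_criticalUrsellFour hlim hxe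
      rwa [hU _ hxe] at h1
    · simp only [hV, if_neg he]
      exact tendsto_const_nhds
  have hL : Tendsto (fun δ => ρ δ ^ (2 * n) * criticalCorr d (2 * n) (z δ) - pairingSum (T δ) n id)
      (𝓝[>] 0) (𝓝 (S (2 * n) x - pairingSum T₀ n id)) :=
    ((hlim (2 * n)).tendsto_at hx).sub (tendsto_pairingSum hTlim n id)
  have hRlim : Tendsto (fun δ => 3 / 2 * wickRemainder (T δ) (V δ) n id) (𝓝[>] 0)
      (𝓝 (3 / 2 * wickRemainder T₀ (fun _ => (0 : ℝ)) n id)) :=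
    Tendsto.const_mul _ (tendsto_wickRemainder hTlim hVlim n id)
  have hR0 : wickRemainder T₀ (fun _ : Fin 4 → Fin (2 * n) => (0 : ℝ)) n id = 0 := by
    simp [wickRemainder]
  have hle : |S (2 * n) x - pairingSum T₀ n id| ≤ 3 / 2 * wickRemainder T₀ (fun _ => (0 : ℝ)) n id :=
    le_of_tendsto_of_tendsto hL.abs hRlim (Filter.Eventually.of_forall hineq)
  rw [hR0, mul_zero, abs_nonpos_iff, sub_eq_zero] at hle
  -- (4) back to the point-level pairing functional
  rw [hle, PairIsing.pairingSum_eq_pow_mul (fun p q => S 2 ![p, q]) T₀ 1 n x id fun i j hij => by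
    simp only [hT₀, id, if_neg hij, one_mul], one_pow, one_mul]

/-- **Gaussian dichotomy, prover's form**: ANY deviation from Wick's rule at ANY even order `2n ≥ 4`
at ONE non-coincident configuration of a pointwise scaling limit of the critical correlators
(`d ≥ 3`, any `ρ`) gives `HasNontrivialU4 S` (clause (iii)). [cite: AizenmanCDM2020, §7, remark after Prop. 7.2 (p. 23)] -/
theorem HasPointwiseScalingLimit.hasNontrivialU4_of_ne_pairingSum (hd : 3 ≤ d) {ρ : ℝ → ℝ}
    {S : CorrFamily d} (hlim : HasPointwiseScalingLimit (criticalCorr d) ρ S) {n : ℕ} (hn : 2 ≤ n)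
    {x : Fin (2 * n) → EuclideanSpace ℝ (Fin d)} (hx : x ∈ NonCoincident d (2 * n))
    (hne : S (2 * n) x ≠ pairingSum (fun p q => S 2 ![p, q]) n x) : HasNontrivialU4 S := by
  by_contra h
  refine hne (hlim.eq_pairingSum_of_limitConnectedFour_eq_zero hd (fun z hz => ?_) hn hx)
  by_contra hz0
  exact h ⟨z, hz, hz0⟩

/-- **Gaussian dichotomy** for pointwise scaling limits of the critical Ising correlators on `ℤ^d`,
`d ≥ 3` (any renormalisation): either `U₄ ≢ 0` on non-coincident quadruples (`HasNontrivialU4`), or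
the limit is the Wick family of its own two-point function at every even order (odd orders vanish by
`eq_zero_of_odd`). [cite: AizenmanCDM2020, §7, Prop. 7.1–7.2 and remark p. 23] [cite: AizenmanCMP1982, Prop. 12.1] -/
theorem HasPointwiseScalingLimit.hasNontrivialU4_or_wick (hd : 3 ≤ d) {ρ : ℝ → ℝ} {S : CorrFamily d}
    (hlim : HasPointwiseScalingLimit (criticalCorr d) ρ S) :
    HasNontrivialU4 S ∨ ∀ n : ℕ, 2 ≤ n → ∀ x ∈ NonCoincident d (2 * n),
      S (2 * n) x = pairingSum (fun p q => S 2 ![p, q]) n x := by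
  by_cases h : HasNontrivialU4 S
  · exact Or.inl h
  · refine Or.inr fun n hn x hx => ?_
    by_contra hne
    exact h (hlim.hasNontrivialU4_of_ne_pairingSum hd hn hx hne)

end Literature.Probability.LatticeModels

end
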